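import Summits.QuantumFields.YangMills.Theorems.BalabanUVNodesN20InterpolatedClassFreeEnergy
import Mathlib.Analysis.Convex.SpecificFunctions.Basic

/-!
# BalabanUVNodes ∕ node N20 (NE7b) — THE INTERPOLATED (TWO-RUN) VARIANCE LETTER FROM ONE-RUN-LAW STATISTICS: along `μ_s ∝ A^{1−s}B^s` the tilted variance of the
# increment `h = log B − log A` is at most `2·e^{2Δ}` times the MIXTURE second moment `Σ_T ((p+q)∕2)(h − c)²` of edition 2 (`c = log ΣB − log ΣA`,
# `Δ` = midpoint defect = −log affinity) — so FILE 2's s-uniform letter (V) follows from edition 2's one-run-law letter as soon as the affinity is a priori bounded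
# below, and (FILE 4's witness) not otherwise

Cell `pub-ymgap` (HUMAN RULING D-0062 Track A ∕ director-ym R399 (3a) second-wave width seats), WIDTH SEAT `pub-ymgap-dag-n20-w4` (node n20 = NE7b),
generation g2, CLAIM-4 ∕ INTENT-4.  Key item K3⁷ `SpineGivenEndpointR13SepCoPH` (stmt-QuantumFields-20544; skeleton of record v5 941dddb108cbaacf, stub 2
`stub_expansion13H`); filed `--kind proof --supports … --as helper`.  COUNT-NEUTRAL.  THEOREMS ONLY (0 `def`, 0 `instance`, 0 `sorry`).  ADDITIVE — imports this
lineage's FILE 1 `…N20InterpolatedClassFreeEnergy` (p611539) ONLY; modifies nothing.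

WHY.  CRIT-1's triage of `hellinger-free-energy-road` (06:42Z) §5: «covariance bounds … uniformly in s need a polymer representation of μ_s itself … Price it as two-run
unless the line shows the s-uniform expansion follows from the two one-run expansions (log-convexity may give it; not shown)».  The card's EDITION 2 (07:18Z) moved
its load-bearing supply to one-run-law statistics (Sketch ed.2 §10: the mixture second moment, the moment bootstrap `mixture_moment_le_of_regime`, the Padé bound
`1 − bc ≤ ¼·M`), keeping the interpolated ensemble as an optional sharpening.  This file shows the «log-convexity» remark in the kernel, quantitatively:
* §1 [folklore] `chord_sub_two_midpointDefect_le` — `0 ≤ f″` on `[0,1]` ⇒ `(1−s)f 0 + s f 1 − 2Δ_f ≤ f s`, `Δ_f = (f 0 + f 1)∕2 − f(½)` (three tangent lines at `½`,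
  FILE 1's `taylorTwo_le_of_le_deriv2`); ★ `chord_sub_two_defect_le_log_interpolatedSum` — at the class weights: `(1−s)·log ΣA + s·log ΣB − 2Δ ≤ log Σ_T A e^{s h}`
  (the interpolated partition function is within `e^{−2Δ}` of the geometric chord).
* §2 [folklore] `mul_exp_le_exp_mul_arith` — termwise `A e^{s h} ≤ e^{s c}((1−s)A + s(ΣA∕ΣB)B)` (convexity of `exp` on `[0, h − c]`): the tilted weight is dominated by
  the ARITHMETIC interpolation of the two normalised laws, rescaled.
* §3 ★★ `tiltedMoment_le_two_exp_two_defect_mul_mixtureMoment` — `E_{μ_s}[(h − c)²] ≤ 2·e^{2Δ}·Σ_T ((p+q)∕2)(h − c)²` for every `s ∈ [0,1]`; ★★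
  `tiltedVar_le_two_exp_two_defect_mul_mixtureMoment` — the card's hV expression (tilted VARIANCE) obeys the same bound (a variance is at most the second moment about
  any constant).  Consequently, in edition 2's regime (`Δ ≤ log 2`, affinity `≥ ½`) FILE 2's hypothesis holds with `V := 8·M`, and the interpolated letter is
  EQUIVALENT up to constants to the mixture-moment letter there (converse direction: FILE 1 `midpointDefect_classFreeEnergy_le` + Sketch §10); outside the regime
  FILE 4's two-point witness (`Δ → ∞`, one-run variances `→ 0`, `M = 2 log²y`) shows no such control.
ADJACENT (cited, not re-typed): dag-n20-w5 g3 CLAIM-1 (08:01Z) `…N20HellingerEndpoint{Kernel,Road}` — edition 2's §10 in `Theorems/` and the STRONGER road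
`exists_hybridNE7_of_mixtureMoment_and_response` straight from `1 − bc ≤ ¼M` (no regime, no interpolation) through this lineage's p609004; the present file does NOT
state a road theorem (that one is theirs) — it relates the two V-currencies.  dag-n19-w4 g5 p614272 `…N19VarianceOfAnalyticTilt` (one-run suppliers); dag-n19-w2 g5
p612301; this lineage's p607565 ∕ p609004 ∕ p611539 ∕ p612607 ∕ p614047 and CLAIM-3 `…N20VarianceCurrencyTwoSided`.

HONEST FRAMING.  [folklore] one-variable real analysis on finite sums of exponentials; `M`, `Δ`, the regime and the letters are HYPOTHESIS SHAPES — unproved, NOT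
PRINTED for d = 4, produced by nobody; NO estimate of the programme; nothing of Bałaban's asserted or instantiated; NE7 ∕ NE7b ∕ NE7c NOT PRINTED as two-run statements
for d = 4 and NOT proved; N19 ∕ N20 ∕ N21 NOT discharged; K3⁷ OPEN, v5 STANDS, not claimed; no summit statement is proved by this seat; counts UNMOVED (typed 28∕28 ·
discharged 5∕28).  One finite four-torus programme at fixed ε — NOT ℝ⁴, NOT infinite volume, NOT OS, NOT a mass gap, NOT the Clay problem (R4 closes the conditional
finite-𝕋⁴ rung `BalabanLadder.UV` only).  0 `def`; 0 `sorry`; standard axioms; no cite tags.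
-/

noncomputable section

namespace Summit.QuantumFields.YangMills.BalabanUVNodes.N20TiltedVarianceOfMixtureMoment

open Finset Set
open Summit.QuantumFields.YangMills.BalabanUVNodes.N20InterpolatedClassFreeEnergy
  (taylorTwo_le_of_le_deriv2 hasDerivAt_log_interpolatedSum hasDerivAt_interpolatedMean interpolatedVar_nonneg
   interpolatedVar_eq_sum_sq interpolatedSum_pos sum_mul_exp_zero_mul sum_mul_exp_one_mul sum_mul_exp_half_mul)

variable {ι : Type*}

/-! ## §1 A convex function on `[0,1]` lies above its chord minus twice its midpoint defect [folklore] -/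

/-- **CHORD MINUS TWICE THE MIDPOINT DEFECT** [folklore].  `HasDerivAt f f′`, `HasDerivAt f′ f″` everywhere and `0 ≤ f″` on `[0,1]` ⇒ for `s ∈ [0,1]`:
`(1 − s)·f 0 + s·f 1 − 2·((f 0 + f 1)∕2 − f(½)) ≤ f s` — three tangent-line bounds at `x = ½` (towards `0`, `1` and `s`). -/
theorem chord_sub_two_midpointDefect_le {f f' f'' : ℝ → ℝ}
    (hf : ∀ s, HasDerivAt f (f' s) s) (hf' : ∀ s, HasDerivAt f' (f'' s) s)
    (h0 : ∀ s ∈ Icc (0:ℝ) 1, 0 ≤ f'' s) {s : ℝ} (hs : s ∈ Icc (0:ℝ) 1) :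
    (1 - s) * f 0 + s * f 1 - 2 * ((f 0 + f 1) / 2 - f (1 / 2)) ≤ f s := by
  have hh : (1/2 : ℝ) ∈ Icc (0:ℝ) 1 := ⟨by norm_num, by norm_num⟩
  have t0 := taylorTwo_le_of_le_deriv2 hf hf' h0 hh (left_mem_Icc.2 zero_le_one)
  have t1 := taylorTwo_le_of_le_deriv2 hf hf' h0 hh (right_mem_Icc.2 zero_le_one)
  have ts := taylorTwo_le_of_le_deriv2 hf hf' h0 hh hs
  obtain ⟨hs0, hs1⟩ := hs
  rcases le_total s (1/2) with hle | hge
  · nlinarith [mul_nonneg (sub_nonneg.2 hle) (sub_nonneg.2 (show f 1 - f (1/2) - f' (1/2) * (1 - 1/2) ≥ 0 by nlinarith [t1]))]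
  · nlinarith [mul_nonneg (sub_nonneg.2 hge) (sub_nonneg.2 (show f 0 - f (1/2) - f' (1/2) * (0 - 1/2) ≥ 0 by nlinarith [t0]))]

section ClassWeights
variable {T : Finset ι} {A B : ι → ℝ}

/-- **★ THE INTERPOLATED PARTITION FUNCTION LIES ABOVE THE GEOMETRIC CHORD UP TO `e^{−2Δ}`** [folklore].  Positive class weights on `T ≠ ∅`, `h = log B − log A`,
`Z(s) = Σ_T A·e^{s·h}`, `Δ = (log ΣA + log ΣB)∕2 − log Σ√(A·B)`: for `s ∈ [0,1]`, `(1 − s)·log ΣA + s·log ΣB − 2Δ ≤ log Z(s)` (log-convexity of `Z`, FILE 1). -/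
theorem chord_sub_two_defect_le_log_interpolatedSum (hT : T.Nonempty) (hA : ∀ τ ∈ T, 0 < A τ) (hB : ∀ τ ∈ T, 0 < B τ)
    {s : ℝ} (hs : s ∈ Icc (0:ℝ) 1) :
    (1 - s) * Real.log (∑ τ ∈ T, A τ) + s * Real.log (∑ τ ∈ T, B τ)
        - 2 * ((Real.log (∑ τ ∈ T, A τ) + Real.log (∑ τ ∈ T, B τ)) / 2 - Real.log (∑ τ ∈ T, Real.sqrt (A τ * B τ)))
      ≤ Real.log (∑ τ ∈ T, A τ * Real.exp (s * (Real.log (B τ) - Real.log (A τ)))) := by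
  have h := chord_sub_two_midpointDefect_le
    (hasDerivAt_log_interpolatedSum (fun τ => Real.log (B τ) - Real.log (A τ)) hT hA)
    (hasDerivAt_interpolatedMean (fun τ => Real.log (B τ) - Real.log (A τ)) hT hA)
    (fun s _ => interpolatedVar_nonneg (fun τ => Real.log (B τ) - Real.log (A τ)) hT hA s) hs
  rwa [sum_mul_exp_zero_mul, sum_mul_exp_one_mul hA hB, sum_mul_exp_half_mul hA hB] at h

/-- [folklore] termwise: along the interpolation the tilted weight is dominated by the arithmetic interpolation of the two NORMALISED laws, scaled back —
`A·e^{s·h} ≤ e^{s·c}·((1 − s)·A + s·(ΣA∕ΣB)·B)` with `c = log ΣB − log ΣA` (convexity of `exp` on `[0, h − c]`). -/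
theorem mul_exp_le_exp_mul_arith (hT : T.Nonempty) (hA : ∀ τ ∈ T, 0 < A τ) (hB : ∀ τ ∈ T, 0 < B τ)
    {s : ℝ} (hs : s ∈ Icc (0:ℝ) 1) {τ : ι} (hτ : τ ∈ T) :
    A τ * Real.exp (s * (Real.log (B τ) - Real.log (A τ)))
      ≤ Real.exp (s * (Real.log (∑ σ ∈ T, B σ) - Real.log (∑ σ ∈ T, A σ)))
          * ((1 - s) * A τ + s * ((∑ σ ∈ T, A σ) / (∑ σ ∈ T, B σ)) * B τ) := by
  have hZA : 0 < ∑ σ ∈ T, A σ := sum_pos hA hT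
  have hZB : 0 < ∑ σ ∈ T, B σ := sum_pos hB hT
  set c := Real.log (∑ σ ∈ T, B σ) - Real.log (∑ σ ∈ T, A σ) with hc
  set u := Real.log (B τ) - Real.log (A τ) - c with hu
  -- convexity of `exp`: `e^{s·u} ≤ (1 − s)·e^0 + s·e^u`
  have hconv : Real.exp (s * u) ≤ (1 - s) * 1 + s * Real.exp u := by
    have := (convexOn_exp).2 (Set.mem_univ (0:ℝ)) (Set.mem_univ u) (sub_nonneg.2 hs.2) hs.1 (by ring)
    simpa [smul_eq_mul, Real.exp_zero] using this
  have heu : Real.exp u = B τ / A τ * ((∑ σ ∈ T, A σ) / ∑ σ ∈ T, B σ) := by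
    rw [hu, hc, show Real.log (B τ) - Real.log (A τ) - (Real.log (∑ σ ∈ T, B σ) - Real.log (∑ σ ∈ T, A σ))
      = (Real.log (B τ) - Real.log (A τ)) - (Real.log (∑ σ ∈ T, B σ) - Real.log (∑ σ ∈ T, A σ)) by ring,
      Real.exp_sub, Real.exp_sub, Real.exp_sub, Real.exp_log (hB τ hτ), Real.exp_log (hA τ hτ), Real.exp_log hZB, Real.exp_log hZA]
    field_simp
  have hsplit : Real.exp (s * (Real.log (B τ) - Real.log (A τ))) = Real.exp (s * c) * Real.exp (s * u) := by
    rw [← Real.exp_add]; congr 1; rw [hu]; ring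
  rw [hsplit]
  have hA0 := hA τ hτ
  calc A τ * (Real.exp (s * c) * Real.exp (s * u))
      = Real.exp (s * c) * (A τ * Real.exp (s * u)) := by ring
    _ ≤ Real.exp (s * c) * (A τ * ((1 - s) * 1 + s * Real.exp u)) :=
        mul_le_mul_of_nonneg_left (mul_le_mul_of_nonneg_left hconv hA0.le) (Real.exp_pos _).le
    _ = Real.exp (s * c) * ((1 - s) * A τ + s * ((∑ σ ∈ T, A σ) / (∑ σ ∈ T, B σ)) * B τ) := by
        rw [heu]; field_simp

/-- **★★ THE TILTED SECOND MOMENT ABOUT THE TARGET CONSTANT IS AT MOST `2·e^{2Δ}` TIMES THE MIXTURE SECOND MOMENT** [folklore].  Positive weights on `T ≠ ∅`,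
`h = log B − log A`, `c = log ΣB − log ΣA`, normalised laws `p = A∕ΣA`, `q = B∕ΣB`: for every `s ∈ [0,1]`,
`Σ_T A e^{s h}(h − c)² ∕ Σ_T A e^{s h} ≤ 2·e^{2Δ}·Σ_T ((p + q)∕2)·(h − c)²` — numerator by `mul_exp_le_exp_mul_arith` (`(1−s)p + s q ≤ p + q`), denominator by
`chord_sub_two_defect_le_log_interpolatedSum`.  The right-hand side is edition 2's RANGE-FREE letter (Sketch §10), an expectation under each run's OWN law. -/
theorem tiltedMoment_le_two_exp_two_defect_mul_mixtureMoment (hT : T.Nonempty) (hA : ∀ τ ∈ T, 0 < A τ) (hB : ∀ τ ∈ T, 0 < B τ)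
    {s : ℝ} (hs : s ∈ Icc (0:ℝ) 1) :
    (∑ τ ∈ T, A τ * Real.exp (s * (Real.log (B τ) - Real.log (A τ)))
        * (Real.log (B τ) - Real.log (A τ) - (Real.log (∑ σ ∈ T, B σ) - Real.log (∑ σ ∈ T, A σ))) ^ 2)
      / (∑ τ ∈ T, A τ * Real.exp (s * (Real.log (B τ) - Real.log (A τ))))
    ≤ 2 * Real.exp (2 * ((Real.log (∑ τ ∈ T, A τ) + Real.log (∑ τ ∈ T, B τ)) / 2 - Real.log (∑ τ ∈ T, Real.sqrt (A τ * B τ))))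
        * ∑ τ ∈ T, (A τ / (∑ σ ∈ T, A σ) + B τ / (∑ σ ∈ T, B σ)) / 2
            * (Real.log (B τ) - Real.log (A τ) - (Real.log (∑ σ ∈ T, B σ) - Real.log (∑ σ ∈ T, A σ))) ^ 2 := by
  have hZA : 0 < ∑ σ ∈ T, A σ := sum_pos hA hT
  have hZB : 0 < ∑ σ ∈ T, B σ := sum_pos hB hT
  set ZA := ∑ σ ∈ T, A σ with hZAdef
  set ZB := ∑ σ ∈ T, B σ with hZBdef
  set c := Real.log ZB - Real.log ZA with hc
  set Δ := (Real.log ZA + Real.log ZB) / 2 - Real.log (∑ τ ∈ T, Real.sqrt (A τ * B τ)) with hΔ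
  set Z := ∑ τ ∈ T, A τ * Real.exp (s * (Real.log (B τ) - Real.log (A τ))) with hZdef
  set M := ∑ τ ∈ T, (A τ / ZA + B τ / ZB) / 2 * (Real.log (B τ) - Real.log (A τ) - c) ^ 2 with hM
  have hZpos : 0 < Z := interpolatedSum_pos (fun τ => Real.log (B τ) - Real.log (A τ)) hT hA s
  -- denominator: `Z ≥ e^{(1−s) log ZA + s log ZB − 2Δ} = e^{s c}·ZA·e^{−2Δ}`
  have hden : Real.exp (s * c) * ZA * Real.exp (-(2 * Δ)) ≤ Z := by
    have h := chord_sub_two_defect_le_log_interpolatedSum hT hA hB hs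
    have h' : Real.exp ((1 - s) * Real.log ZA + s * Real.log ZB - 2 * Δ) ≤ Z := by
      rw [← Real.exp_log hZpos]; exact Real.exp_le_exp.2 h
    have e : Real.exp (s * c) * ZA * Real.exp (-(2 * Δ)) = Real.exp ((1 - s) * Real.log ZA + s * Real.log ZB - 2 * Δ) := by
      conv_lhs => rw [← Real.exp_log hZA]
      rw [← Real.exp_add, ← Real.exp_add]; congr 1; rw [hc]; ring
    rw [e]; exact h'
  -- numerator: `≤ e^{s c}·ZA·2M`
  have hnum : ∑ τ ∈ T, A τ * Real.exp (s * (Real.log (B τ) - Real.log (A τ))) * (Real.log (B τ) - Real.log (A τ) - c) ^ 2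
      ≤ Real.exp (s * c) * ZA * (2 * M) := by
    calc ∑ τ ∈ T, A τ * Real.exp (s * (Real.log (B τ) - Real.log (A τ))) * (Real.log (B τ) - Real.log (A τ) - c) ^ 2
        ≤ ∑ τ ∈ T, Real.exp (s * c) * ((1 - s) * A τ + s * (ZA / ZB) * B τ) * (Real.log (B τ) - Real.log (A τ) - c) ^ 2 :=
          sum_le_sum fun τ hτ => mul_le_mul_of_nonneg_right (mul_exp_le_exp_mul_arith hT hA hB hs hτ) (sq_nonneg _)
      _ ≤ ∑ τ ∈ T, Real.exp (s * c) * (A τ + (ZA / ZB) * B τ) * (Real.log (B τ) - Real.log (A τ) - c) ^ 2 := by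
          refine sum_le_sum fun τ hτ => mul_le_mul_of_nonneg_right (mul_le_mul_of_nonneg_left ?_ (Real.exp_pos _).le) (sq_nonneg _)
          have := hA τ hτ; have := hB τ hτ; have := div_pos hZA hZB
          nlinarith [hs.1, hs.2, mul_pos (div_pos hZA hZB) (hB τ hτ)]
      _ = Real.exp (s * c) * ZA * (2 * M) := by
          simp only [hM, Finset.mul_sum]
          refine sum_congr rfl fun τ _ => ?_
          field_simp
  -- combine
  rw [div_le_iff₀ hZpos]
  have hM0 : 0 ≤ M := sum_nonneg fun τ hτ => mul_nonneg (by
    have := (hA τ hτ).le; have := (hB τ hτ).le; positivity) (sq_nonneg _)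
  have hE : Real.exp (s * c) * ZA * (2 * M) ≤ 2 * Real.exp (2 * Δ) * M * Z := by
    have h1 : Real.exp (s * c) * ZA * (2 * M) = (2 * Real.exp (2 * Δ) * M) * (Real.exp (s * c) * ZA * Real.exp (-(2 * Δ))) := by
      have : Real.exp (2 * Δ) * Real.exp (-(2 * Δ)) = 1 := by rw [← Real.exp_add]; simp
      calc Real.exp (s * c) * ZA * (2 * M) = Real.exp (s * c) * ZA * (2 * M) * (Real.exp (2 * Δ) * Real.exp (-(2 * Δ))) := by rw [this, mul_one]
        _ = _ := by ring
    rw [h1]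
    exact mul_le_mul_of_nonneg_left hden (by positivity)
  exact hnum.trans hE

/-- **★★ THE s-UNIFORM TILTED VARIANCE FROM THE MIXTURE SECOND MOMENT** [folklore].  Same data; for every `s ∈ [0,1]` the tilted VARIANCE (the card's hV
expression, edition 1's interpolated-ensemble letter) is at most `2·e^{2Δ}·M`, `M = Σ_T ((p+q)∕2)(h − c)²` edition 2's mixture second moment — since a variance is
at most the second moment about any constant.  So the two-run interpolated letter (V) of FILE 2 FOLLOWS from one-run-LAW statistics as soon as `Δ` (equivalently
the affinity) is a priori bounded — CRIT-1 §5's «log-convexity may give it; not shown», shown; FILE 4's witness says the a-priori bound cannot be dropped. -/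
theorem tiltedVar_le_two_exp_two_defect_mul_mixtureMoment (hT : T.Nonempty) (hA : ∀ τ ∈ T, 0 < A τ) (hB : ∀ τ ∈ T, 0 < B τ)
    {s : ℝ} (hs : s ∈ Icc (0:ℝ) 1) :
    (∑ τ ∈ T, A τ * Real.exp (s * (Real.log (B τ) - Real.log (A τ))) * (Real.log (B τ) - Real.log (A τ)) ^ 2)
          / (∑ τ ∈ T, A τ * Real.exp (s * (Real.log (B τ) - Real.log (A τ))))
        - ((∑ τ ∈ T, A τ * Real.exp (s * (Real.log (B τ) - Real.log (A τ))) * (Real.log (B τ) - Real.log (A τ)))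
          / (∑ τ ∈ T, A τ * Real.exp (s * (Real.log (B τ) - Real.log (A τ))))) ^ 2
    ≤ 2 * Real.exp (2 * ((Real.log (∑ τ ∈ T, A τ) + Real.log (∑ τ ∈ T, B τ)) / 2 - Real.log (∑ τ ∈ T, Real.sqrt (A τ * B τ))))
        * ∑ τ ∈ T, (A τ / (∑ σ ∈ T, A σ) + B τ / (∑ σ ∈ T, B σ)) / 2
            * (Real.log (B τ) - Real.log (A τ) - (Real.log (∑ σ ∈ T, B σ) - Real.log (∑ σ ∈ T, A σ))) ^ 2 := by
  refine le_trans ?_ (tiltedMoment_le_two_exp_two_defect_mul_mixtureMoment hT hA hB hs)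
  -- variance ≤ second moment about `c`: `Var = Σ w (h − m)²∕Z ≤ Σ w (h − c)²∕Z`
  rw [interpolatedVar_eq_sum_sq (fun τ => Real.log (B τ) - Real.log (A τ)) hT hA s]
  have hZpos := interpolatedSum_pos (fun τ => Real.log (B τ) - Real.log (A τ)) hT hA s
  set Z := ∑ τ ∈ T, A τ * Real.exp (s * (Real.log (B τ) - Real.log (A τ))) with hZdef
  set m := (∑ σ ∈ T, A σ * Real.exp (s * (Real.log (B σ) - Real.log (A σ))) * (Real.log (B σ) - Real.log (A σ))) / Z with hm
  set c := Real.log (∑ σ ∈ T, B σ) - Real.log (∑ σ ∈ T, A σ) with hc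
  rw [div_le_div_iff_of_pos_right hZpos]
  -- `Σ w (h−c)² − Σ w (h−m)² = Z·(m − c)² ≥ 0`
  have key : ∑ τ ∈ T, A τ * Real.exp (s * (Real.log (B τ) - Real.log (A τ))) * (Real.log (B τ) - Real.log (A τ) - c) ^ 2
      - ∑ τ ∈ T, A τ * Real.exp (s * (Real.log (B τ) - Real.log (A τ))) * (Real.log (B τ) - Real.log (A τ) - m) ^ 2
      = Z * (m - c) ^ 2 := by
    have e : ∀ τ ∈ T, A τ * Real.exp (s * (Real.log (B τ) - Real.log (A τ))) * (Real.log (B τ) - Real.log (A τ) - c) ^ 2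
        - A τ * Real.exp (s * (Real.log (B τ) - Real.log (A τ))) * (Real.log (B τ) - Real.log (A τ) - m) ^ 2
        = (m - c) * (2 * (A τ * Real.exp (s * (Real.log (B τ) - Real.log (A τ))) * (Real.log (B τ) - Real.log (A τ))))
          - (m - c) * (m + c) * (A τ * Real.exp (s * (Real.log (B τ) - Real.log (A τ)))) := fun τ _ => by ring
    rw [← sum_sub_distrib, sum_congr rfl e, sum_sub_distrib, ← mul_sum, ← mul_sum, ← mul_sum]
    have hmZ : ∑ τ ∈ T, A τ * Real.exp (s * (Real.log (B τ) - Real.log (A τ))) * (Real.log (B τ) - Real.log (A τ)) = m * Z := by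
      rw [hm, div_mul_cancel₀ _ hZpos.ne']
    rw [hmZ, ← hZdef]
    ring
  nlinarith [key, mul_nonneg hZpos.le (sq_nonneg (m - c))]

end ClassWeights

end Summit.QuantumFields.YangMills.BalabanUVNodes.N20TiltedVarianceOfMixtureMoment

end
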